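import Literature.MathematicalPhysics.QuantumFieldTheory.Balaban1983to89.Node00.Record12CarriersB12Package
import Literature.MathematicalPhysics.QuantumFieldTheory.Balaban1983to89.Node00.CarriersB12FundamentalCase
import Literature.MathematicalPhysics.QuantumFieldTheory.Balaban1983to89.Node00.Record12Residuals
import Literature.MathematicalPhysics.QuantumFieldTheory.Balaban1983to89.Node00.Record13NumericsOfThm1CCMW
import Literature.MathematicalPhysics.QuantumFieldTheory.Balaban1983to89.Node00.Record13CarriersXPinnedH

/-!
# NODE N09 ([Balaban1987RG1] Lemma 4 (3.53) p. 280), LOCATED HOLLOW-CLOSURE CERTIFICATE — node00-def-B12's HONEST HORN `B12Provisos Rz cB λ` (package ∧ «all the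
# restrictions» ∧ `0 ∈ (3.31)`) IS INHABITED AT THE RESIDUAL §2 DATA OF RECORD `RzOfRecord` (the UNIT recipe) BY THE JUNK LETTERS `𝐊 = 𝐀₂ = 0`; hence g32's Stage-12 leaf
# `B12LeafOfRecord₁₂ θ λ₁₂ P` — N09's conjunct 1 in package form — holds for SOME zero-letter `λ₁₂` at EVERY run of every Stage-12 parameter carrying the residuals of record, and
# the four-pin engine's N09 socket at the X-pinned parameter `θ.pinX3H λ₈ λ₁₂ λ₁₃` is met WITHOUT print's letters — at the V17∕V18 witness `θ₁₅ᶜᶜᴹᵂ` BY NAME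
# (companion of `…N09B12PackageAtRzOfRecordLocated`: there, WHY — at the unit recipe (iv) is idle and the package's identity fields certify flat letters only)

T. Bałaban, *Renormalization group approach to lattice gauge field theories. I*, Commun. Math. Phys. **109** (1987) 249–301 [Balaban1987RG1] (= [I]);
[15] = [Balaban1985Variational], Commun. Math. Phys. **102** (1985) 277–309.  TRACK A (YM-PLAN §2b), WIDTH SEAT `pub-ymgap-dag-n09-w4` (HUMAN RULING D-0149 ∕
director-ym №197; w4 = overflow seat of node n09, UNLISTED located piece under W-SEAT-START-LIST v2 §n09 item 1's package currency).  Key of record it serves: K1⁷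
`StabilityBAtRecordR13SepCoPH` = stmt-QuantumFields-20542 (`--supports`, helper; count-neutral).

WHY.  Referee READ-115 (B4) fixed the three displays a count line at a [B12] record must carry — the by-reference package `B12Package`, satisfiable «all the restrictions», and
`0 ∈ (3.31)` — and node00-def-B12 typed them as ONE horn `B12Provisos` whose `leaf` is N09's conjunct 1 (`Record12CarriersB12Package` §0).  At the unit recipe the frames of
record have background functions `U_n ≡ 1`, `J_n ≡ 0`, so condition (iv) is idle and the package's identity fields (3.38) ∕ (3.39)+(3.37) ∕ (3.42) read `∂V = ∂(V^u)`, … with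
unit background members (companion file).  THIS FILE shows the horn is then INHABITED by JUNK: the zero-letter `JInputs` (`Φ₀ = (1, 0)`, `𝐇 = H₁ = ℓ = 0`, unit gauge
transformations, `ctr = id`, `𝐊 = 𝐀₂ = 0`: identity fields `1 = 1` ∕ `0 = 0`, size fields `0 < (positive)` ∕ `0 ≤ B₃|B′|`, costs `1 ≤ e^{(≥0)}` — lit-balaban r20's
`B12Lemma4DataInstance.trivInputs` pattern, here at the FRAMES OF RECORD in the `SU(N)` model with `π = slProj N`), dag-n09-c's region theorems (`X ⊆ □̃³`) and his
`exists_residB12Run_restrictions` instance (fundamental case, `(3.31) ∋ 0`, constants meeting every restriction) with its letters REPLACED by zero give `B12Provisos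
(RzOfRecord F N K) cB λ`; `Classical.choose` per run gives a layer `λ₁₂` at every Stage-12 parameter with `HasResidualsOfRecord`, `0 < O(1)LMB`, cube size `≥ 1` — in
particular at `θ₁₅ᶜᶜᴹᵂ.toStage12Params` (`hasResidualsOfRecord_theta13OfThm1CCMW`, `O(1)LMB = 6L + 1`, `M = Lʲ`) — and dag-n05-d's `socket09_pinX3H_iff` (`Iff.rfl`) carries
it to the four-pin engine's `h09` socket at `θ.pinX3H λ₈ λ₁₂ λ₁₃` for EVERY `λ₈`, `λ₁₃`.

WHAT THIS MEANS FOR THE PLAN (located; for plan ∕ dag-lead ∕ referees): a K1 skeleton that pins N09 BY NAME at a record whose `Rz` is the unit recipe (the v2∕v3 device used for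
N08 ∕ N12) does NOT bar a hollow closure of conjunct 1 — the junk closer is displayed here so that referees can cite it; print's content needs 11b's `Sect2.Residual.bgI` pinned to
the minimisers of record first (companion file).  Nothing here touches conjunct 2, the K0 stubs, or any count.

WHAT IS PROVED (kernel bookkeeping; theorems only, def-free, sorry-free, standard axioms).  §1 private faces of the unit recipe (`subst; rfl`) and the unit pair in the upper space
of record.  §2 (private `nonempty_jInputs_zero`) `nonempty_b12Package_of_eq_unit_of_zero_letters`, `exists_b12Provisos_of_eq_unit`.  §3 `exists_b12Provisos_RzOfRecord`,
`exists_lam12_b12Provisos_of_hasResidualsOfRecord`, `exists_lam12_b12LeafOfRecord₁₂_of_hasResidualsOfRecord`, `exists_lam12_b12LeafOfRecord₁₂_theta13OfThm1CCMW`.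
§4 `exists_lam12_socket09_pinX3H_of_hasResidualsOfRecord`, `exists_lam12_socket09_pinX3H_theta13OfThm1CCMW`.

HONEST FRAMING: LOCATED, count-neutral kernel bookkeeping on NODE 00's objects (read BY NAME, nothing re-declared); the junk letters are a witness for the BINDERS, NOT objects
of print — this is NOT Lemma 4 for `U_j(□₀, ·)`; NO estimate of Bałaban's is proved or denied; N09 NOT discharged; K0⁷ ∕ K1⁷ NOT closed; one finite four-torus programme at fixed
`ε = L^{−K}` per run — conditional finite-𝕋⁴ bookkeeping; R4 closes rung `BalabanLadder.UV` only; NOT ℝ⁴, NOT infinite volume, NOT OS, NOT a mass gap, NOT Clay.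
-/

noncomputable section

namespace Summit.QuantumFields.YangMills.BalabanUVNodes.N09B12ProvisosAtRzOfRecordJunkLocated

open Literature.MathematicalPhysics.QuantumFieldTheory.Balaban1983to89
open Literature.MathematicalPhysics.QuantumFieldTheory.Balaban1983to89.Node00
open Literature.MathematicalPhysics.QuantumFieldTheory.Balaban1983to89.T4Continuum (T4Family)
open B12RegularSpaces111 (Frame Region StepConsts space space' expI grad CondIV Satisfies SatisfiesI_III plaq gaugeU)
open B12RegularSpaces111Mono (plaq_one expI_zero unitPair satisfiesI_III_unitPair)
open B12RegularSpaces111Gauge (plaq_gaugeU gaugeU_one)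
open B12Eq18Current (current)
open B12RegularSpaces111SpecialUnitary (suModel)
open B12Lemma4Models (slProj)
open B12Lemma4ConcreteFrame (JInputs LettersAnalyticAt)
open B12Eq311CurrentExpansion (C311)
open scoped Matrix.Norms.L2Operator

/-! ## §1. (private) The faces of the unit recipe at the two [B12] frames of record; the unit pair in the upper space of record -/

section Unit

variable {P : Params} {N M : ℕ} {Rz : Sect2.Residual P (MatA N)}

/-- FACE: `U_m(M˙(·)) ≡ 1` at the frame of `X` (companion's `bg_Un_frameX_of_eq_unit`, private copy). [cite: Balaban1987RG1, (1.15) p.262 (bookkeeping)] -/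
private theorem bg_Un_frameX (hRz : Rz = Sect2.Residual.unit P (MatA N)) (lam : ResidB12Run P N M) (m : ℕ) (V : PBond P 0 → (MatA N)ˣ) :
    (lam.frameX Rz).bg.Un m V = 1 := by
  subst hRz; rfl

/-- FACE: `J_m(M˙(·)) ≡ 0` at the frame of `X`. [cite: Balaban1987RG1, (1.15) p.262 (bookkeeping)] -/
private theorem bg_Jn_frameX (hRz : Rz = Sect2.Residual.unit P (MatA N)) (lam : ResidB12Run P N M) (m : ℕ) (V : PBond P 0 → (MatA N)ˣ) :
    (lam.frameX Rz).bg.Jn m V = 0 := by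
  subst hRz; rfl

/-- FACE: `U_m(M˙(·)) ≡ 1` at the frame of `□₀`. [cite: Balaban1987RG1, (1.15) p.262, p.275 (bookkeeping)] -/
private theorem bg_Un_frameBox (hRz : Rz = Sect2.Residual.unit P (MatA N)) (lam : ResidB12Run P N M) (m : ℕ) (V : PBond P 0 → (MatA N)ˣ) :
    (lam.frameBox Rz).bg.Un m V = 1 := by
  subst hRz; rfl

/-- FACE: `J_m(M˙(·)) ≡ 0` at the frame of `□₀`. [cite: Balaban1987RG1, (1.15) p.262, p.275 (bookkeeping)] -/
private theorem bg_Jn_frameBox (hRz : Rz = Sect2.Residual.unit P (MatA N)) (lam : ResidB12Run P N M) (m : ℕ) (V : PBond P 0 → (MatA N)ˣ) :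
    (lam.frameBox Rz).bg.Jn m V = 0 := by
  subst hRz; rfl

/-- The unit pair `(1, 0)` satisfies (i)–(iv) of the upper space `U′ᶜ_{k+1}(□₀, α₀, α₁, γ₀)` of record over the unit recipe (positive radii, `0 < O(1)LMB`): pub-balaban's
`satisfiesI_III_unitPair` + (iv) at unit backgrounds (companion's `satisfies_unitPair_frameBox_of_eq_unit`, private copy). [cite: Balaban1987RG1, (1.11)–(1.16) p.262, (3.40) p.278] -/
private theorem satisfies_unitPair_frameBox (hRz : Rz = Sect2.Residual.unit P (MatA N)) (𝓜 : B12RegularSpaces111.Model (MatA N)) (lam : ResidB12Run P N M)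
    {cB : ℝ} (hcB : 0 < cB) {α₀ α₁ γ₀ : ℝ} (hα₀ : 0 < α₀) (hα₁ : 0 < α₁) (hγ₀ : 0 < γ₀) :
    Satisfies 𝓜 (lam.frameBox Rz) (lam.csBox cB) α₀ α₁ γ₀ unitPair := by
  have hξ : 0 < (lam.csBox cB).ξ := pow_pos (inv_pos.mpr (Nat.cast_pos.mpr P.L_pos)) _
  have hL : 0 < (lam.csBox cB).L := Nat.cast_pos.mpr P.L_pos
  have hIV : ∀ V : PBond P 0 → (MatA N)ˣ, CondIV (lam.frameBox Rz).bg (lam.frameBox Rz).X₂ (lam.csBox cB) α₀ V := fun V => by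
    refine ⟨fun n _ _ p _ => ?_, fun n _ _ b _ => ?_⟩
    · rw [bg_Un_frameBox hRz, plaq_one, Units.val_one, sub_self, norm_zero]
      positivity
    · rw [bg_Jn_frameBox hRz, Pi.zero_apply, norm_zero]
      positivity
  obtain ⟨hG, hg, U, A', hf, h1, h2, h3⟩ := satisfiesI_III_unitPair (𝓜 := 𝓜) (lam.frameBox Rz) hξ.ne' hcB hα₀ hα₁ hγ₀
  exact ⟨hG, hg, U, A', hf, h1, h2, h3, hIV _, hIV _⟩

end Unit

/-! ## §2. The zero-letter `JInputs` and the package at the unit recipe; the honest horn `B12Provisos` inhabited -/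

section Junk

variable {P : Params} {N M : ℕ} [NeZero N] {Rz : Sect2.Residual P (MatA N)}

omit [NeZero N] in
/-- `exp iξ·0 = 1` as a configuration. [cite: Balaban1987RG1, (1.13) p.262 (bookkeeping)] -/
private theorem expI_zero_cfg (ξ : ℝ) : (fun b : PBond P 0 => expI ξ ((0 : PBond P 0 → MatA N) b)) = 1 := by
  funext b; rw [Pi.zero_apply, expI_zero]; rfl

omit [NeZero N] in
/-- `exp iξ(0 + 0) = 1` as a configuration. [cite: Balaban1987RG1, (1.13) p.262 (bookkeeping)] -/
private theorem expI_zero_add_zero_cfg (ξ : ℝ) :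
    (fun b : PBond P 0 => expI ξ ((0 : PBond P 0 → MatA N) b + (0 : PBond P 0 → MatA N) b)) = 1 := by
  funext b; rw [Pi.zero_apply, add_zero, expI_zero]; rfl

/-- The cost of the unit gauge transformation: `‖1‖·‖1⁻¹‖ ≤ e^{x}` for `0 ≤ x`. [folklore] -/
private theorem cost_one {x : ℝ} (hx : 0 ≤ x) (y : Site P 0) :
    ‖((1 : Site P 0 → (MatA N)ˣ) y : MatA N)‖ * ‖(↑((1 : Site P 0 → (MatA N)ˣ) y)⁻¹ : MatA N)‖ ≤ Real.exp x := by
  simp only [Pi.one_apply, inv_one, Units.val_one, norm_one, mul_one]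
  have := Real.add_one_le_exp x
  linarith

/-- **THE ZERO-LETTER `JInputs` AT THE FRAMES OF RECORD over the unit recipe** (every value of the variables): `Φ₀ = (1, 0)`, `𝐇 = H₁ = 0`, `ℓ = 0`, every gauge transformation `1`,
`ctr = id`, letters `𝐊 = 𝐀₂ = 0`; the identity fields read `1 = 1` ∕ `0 = 0` at the unit backgrounds, the size fields `0 < (positive)` ∕ `0 ≤ B₃|B′|`, the costs `1 ≤ e^{(≥ 0)}`.
A witness for the BINDER; NOT print's letters. [cite: Balaban1987RG1, (3.37)–(3.52) pp.277–280 (bookkeeping: the junk instance)] -/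
private theorem nonempty_jInputs_zero (hRz : Rz = Sect2.Residual.unit P (MatA N)) (lam : ResidB12Run P N M) {cB : ℝ} (hcB : 0 < cB)
    (hB₃ : 0 < lam.consts.B₃) (hO₁ : 0 < lam.consts.O₁) (hM : 0 < lam.consts.M) (hβ : 0 < lam.consts.β) (hα₀ : 0 < lam.consts.α₀) (hα₁ : 0 < lam.consts.α₁)
    (hB'' : 0 ≤ lam.B₃'') (τ : ℝ) {n : ℝ} (hn : 0 ≤ n) :
    Nonempty (JInputs (suModel N) lam.consts (lam.frameX Rz) (lam.frameBox Rz) (lam.csX cB) (lam.csBox cB) lam.regionY (slProj N) lam.idx.η lam.B₃'' lam.α₀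
      lam.idx.j τ n (0 : PBond P 0 → MatA N) (0 : PBond P 0 → MatA N)) := by
  have hL : 0 < lam.consts.L := Nat.cast_pos.mpr P.L_pos
  have hη : 0 < lam.idx.η := pow_pos (inv_pos.mpr (Nat.cast_pos.mpr P.L_pos)) _
  have hx : 0 < lam.consts.L ^ (lam.idx.j - 1) * lam.idx.η := by positivity
  have hS1 : 0 < lam.consts.B₃ ^ 2 * lam.consts.O₁ * lam.consts.M * lam.consts.α₀ * (lam.consts.L ^ (lam.idx.j - 1) * lam.idx.η) := by positivity
  have hS2 : 0 < lam.consts.B₃ * (lam.consts.B₃ * lam.consts.O₁ * lam.consts.M * lam.consts.α₀ * (lam.consts.L ^ (lam.idx.j - 1) * lam.idx.η)) ^ 2 := by positivity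
  have hS3 : 0 < lam.consts.β * lam.consts.α₀ * (lam.consts.L ^ (lam.idx.j - 1) * lam.idx.η) ^ 2 := by positivity
  have hα₀' : 0 < lam.α₀ := hα₀
  have h2β : 0 < 1 + 2 * lam.consts.β := by positivity
  refine ⟨
    { Φ₀ := unitPair
      hΦ₀ := satisfies_unitPair_frameBox hRz (suModel N) lam hcB (mul_pos h2β hα₀) (mul_pos h2β hα₁) hα₀'
      H := 0, H₁ := 0, ℓ := 0, uj := 1, ubar1 := 1, vj := 1, v := 1, ubar := fun _ => 1, w₁ := fun _ => 1
      ctr := fun _ x => x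
      hKgc := fun _ => (suModel N).gc.zero_mem
      hAgc := fun _ => (suModel N).gc.zero_mem
      huj := cost_one (by positivity)
      hubar1 := cost_one (by positivity)
      hvj := cost_one (by positivity)
      hv := cost_one (by positivity)
      hubar := fun _ _ => rfl
      h339 := fun p _ => by
        rw [expI_zero_cfg, bg_Un_frameBox hRz, plaq_gaugeU, plaq_one, mul_one, mul_inv_cancel]
      h342 := fun b _ => by
        rw [expI_zero_cfg, B12Eq44Space.current_one, bg_Jn_frameBox hRz, Pi.zero_apply, smul_zero, mul_zero, zero_mul]
      h338 := fun m _ _ p _ => by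
        rw [bg_Un_frameX hRz, expI_zero_add_zero_cfg, plaq_gaugeU, plaq_one, mul_one, mul_inv_cancel]
      hJn := fun m _ _ b _ => by
        rw [bg_Jn_frameX hRz, Pi.zero_apply, expI_zero_add_zero_cfg, inv_one, mul_one, gaugeU_one, B12Eq44Space.current_one]
      h338₁ := fun m _ _ p _ => by
        rw [bg_Un_frameX hRz, gaugeU_one]
      hJn₁ := fun m _ _ b _ => by
        rw [bg_Jn_frameX hRz, Pi.zero_apply, gaugeU_one, B12Eq44Space.current_one]
      hH := fun b => by rw [Pi.zero_apply, norm_zero]; exact hS1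
      hHd := fun μ ν y => by
        simp only [grad, Pi.zero_apply, sub_self, smul_zero, norm_zero]
        exact hS1
      h45 := fun p _ => by
        simp only [Pi.zero_apply, add_zero, sub_self, smul_zero, norm_zero]
        exact hS2
      hK := fun b => by rw [Pi.zero_apply, norm_zero]; exact hS1
      hKd := fun μ ν y => by
        simp only [grad, Pi.zero_apply, sub_self, smul_zero, norm_zero]
        exact hS1
      h45τ := fun p _ => by
        simp only [Pi.zero_apply, add_zero, sub_self, smul_zero, norm_zero]
        exact hS2
      hA := fun b => by rw [Pi.zero_apply, norm_zero]; positivity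
      hAd := fun μ ν y => by
        simp only [grad, Pi.zero_apply, sub_self, smul_zero, norm_zero]
        positivity
      hS := fun b _ => by
        rw [sub_zero, B12CondIIIJConcreteModels.lapCur_zero, norm_zero]
        exact hS3
      hSτ := fun b _ => by
        rw [smul_zero, sub_zero, B12CondIIIJConcreteModels.lapCur_zero, norm_zero]
        exact hS3
      hA2 := fun b _ => by
        rw [B12CondIIIJConcreteModels.lapCur_zero, norm_zero]
        positivity }⟩

/-- **(C) THE PACKAGE IS INHABITED AT THE UNIT RECIPE BY THE JUNK LETTERS `𝐊 = 𝐀₂ = 0`**: for a residual layer whose letters vanish identically, whose instance has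
`X ⊆ □̃³` (the seven region fields are then dag-n09-c's theorems) and whose constants satisfy «all the restrictions» and the seven further ones, `B12Package Rz cB λ` is
inhabited at `Rz =` the unit recipe (the by-reference `JInputs` := the zero-letter instance; analyticity of constant letters).  A witness for the BINDERS; NOT print's letters;
NOT a discharge of anything. [cite: Balaban1987RG1, Lemma 4 (3.53) p.280 with (3.26)–(3.52) pp.275–280 (bookkeeping: the junk instance)] -/
theorem nonempty_b12Package_of_eq_unit_of_zero_letters (hRz : Rz = Sect2.Residual.unit P (MatA N)) {cB : ℝ} (hcB : 0 < cB) (lam : ResidB12Run P N M)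
    (hX3 : lam.idx.XSites ⊆ lam.idx.boxT 3)
    (hK : ∀ Φ A τ, lam.K Φ A τ = 0) (hA₂ : ∀ Φ A τ B', lam.A₂ Φ A τ B' = 0)
    (hR : B12Sec2to5.Lemma4Restrictions lam.consts)
    (hB : 1 ≤ lam.consts.B₃) (hY : 1 ≤ lam.consts.B₃ ^ 2 * lam.consts.O₁ * lam.consts.M)
    (hα₁ : 16 * (lam.consts.O₁ * lam.consts.M * lam.consts.α₁) ≤ lam.consts.β) (hL10 : 1 + 10 * lam.consts.β ≤ lam.consts.L ^ 2)
    (hB'' : 0 ≤ lam.B₃'') (hres'' : lam.B₃'' * lam.consts.α₃ ≤ lam.consts.β * lam.consts.L⁻¹ ^ 2 * lam.consts.α₀)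
    (hresJ : 4 * ((P.d - 1) * ((2 : ℝ) * C311 1)) * (lam.consts.B₃ ^ 2 * lam.consts.O₁ * lam.consts.M) ^ 2 * lam.consts.α₀ ≤ lam.consts.β) :
    Nonempty (B12Package Rz cB lam) := by
  obtain ⟨hα₀, hα₁', -, -, hβ, -⟩ := hR
  have hB₃ : 0 < lam.consts.B₃ := one_pos.trans_le hB
  have hMnn : 0 ≤ lam.consts.M := Nat.cast_nonneg M
  have hOM : 0 < lam.consts.O₁ * lam.consts.M := by
    by_contra hle
    rw [not_lt] at hle
    have : lam.consts.B₃ ^ 2 * lam.consts.O₁ * lam.consts.M ≤ 0 := by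
      rw [mul_assoc]; exact mul_nonpos_of_nonneg_of_nonpos (sq_nonneg _) hle
    linarith
  have hMpos : 0 < lam.consts.M := by
    rcases hMnn.eq_or_lt with hM0 | hM0
    · rw [← hM0, mul_zero] at hOM; exact absurd hOM (lt_irrefl 0)
    · exact hM0
  have hO₁ : 0 < lam.consts.O₁ := by
    by_contra hle
    rw [not_lt] at hle
    have : lam.consts.O₁ * lam.consts.M ≤ 0 := mul_nonpos_iff.mpr (Or.inr ⟨hle, hMpos.le⟩)
    linarith
  refine ⟨
    { hB := hB, hY := hY, hα₁ := hα₁, hL10 := hL10, hB'' := hB'', hres'' := hres'', hresJ := hresJ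
      hXb := lam.frameX_X_bonds_subset_regionY Rz hX3
      hXd := lam.frameX_X_dpairs_subset_regionY Rz hX3
      hX₂b := lam.frameX_X₂_bonds_subset_regionY Rz hX3
      hX₂p := lam.frameX_X₂_plaqs_subset_X Rz
      hXp' := lam.frameX_X_plaqs_subset_frameBox_X₂ Rz hX3
      hYb' := lam.regionY_bonds_subset_frameBox_X₂ Rz
      hXp := lam.stencil_subset_regionY Rz hX3
      inputs := fun Φ A τ B' _ _ _ _ _ => by
        rw [hK, hA₂]
        exact Classical.choice (nonempty_jInputs_zero hRz lam hcB hB₃ hO₁ hMpos hβ hα₀ hα₁' hB'' τ (norm_nonneg B'))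
      hKan := fun τ _ _ _ _ _ _ b => by
        simp only [hK, Pi.zero_apply]
        exact analyticAt_const
      hA2an := fun τ _ _ _ _ _ _ b => by
        simp only [hA₂, Pi.zero_apply]
        exact analyticAt_const }⟩

/-- **(C) THE HONEST HORN `B12Provisos` IS INHABITED AT THE UNIT RECIPE** (cube size `M ≥ 1`; `L ≥ 2` holds on every `Setup.Params`; `0 < O(1)LMB`): SOME residual layer — dag-n09-c's
`exists_residB12Run_restrictions` instance in the fundamental case `X ⊆ □̃²` with `(3.31) ∋ 0` and constants meeting every restriction, its letters REPLACED by `𝐊 = 𝐀₂ = 0` — carries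
package ∧ restrictions ∧ `0 ∈ (3.31)`.  JUNK witness for the binders (ref-C READ-115 (B4)'s three displays are jointly satisfiable at the record's `Rz` WITHOUT print's letters).
[cite: Balaban1987RG1, Lemma 4 p.280, §3 pp.276–280 («all the restrictions»), p.277 («At first let us take 𝐀 = 0») (bookkeeping)] -/
theorem exists_b12Provisos_of_eq_unit (hRz : Rz = Sect2.Residual.unit P (MatA N)) (hM : 1 ≤ M) {cB : ℝ} (hcB : 0 < cB) :
    ∃ lam : ResidB12Run P N M, lam.idx.XSites ⊆ lam.idx.boxT 2 ∧ (∀ Φ A τ, lam.K Φ A τ = 0) ∧ (∀ Φ A τ B', lam.A₂ Φ A τ B' = 0) ∧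
      B12Provisos Rz cB lam := by
  obtain ⟨lam, hX, h0, hR, hB, hY, hα₁, hL10, hB'', hres'', hresJ⟩ := exists_residB12Run_restrictions P N M hM P.hL.2
  refine ⟨{ lam with K := fun _ _ _ _ => 0, A₂ := fun _ _ _ _ _ => 0 }, hX, fun _ _ _ => rfl, fun _ _ _ _ => rfl, ⟨?_, hR, h0⟩⟩
  exact nonempty_b12Package_of_eq_unit_of_zero_letters hRz hcB _ (IdxB12.XSites_subset_boxT_three_of_two _ hX) (fun _ _ _ => rfl) (fun _ _ _ _ => rfl)
    hR hB hY hα₁ hL10 hB'' hres'' hresJ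

end Junk

/-! ## §3. At `RzOfRecord F N K`, at a Stage-12 parameter carrying the residuals of record, at `θ₁₅ᶜᶜᴹᵂ` by name -/

section JunkRecord

variable {F : T4Family} {N : ℕ} [NeZero N]

omit [NeZero N] in
/-- `RzOfRecord F N K` IS the unit recipe (`rfl`; companion's `rzOfRecord_eq_unit`, private copy). [cite: Balaban1987RG1, (1.15) p.262 (bookkeeping)] -/
private theorem rzOfRecord_eq (K : ℕ) : RzOfRecord F N K = Sect2.Residual.unit (F.P K) (MatA N) := rfl

/-- At a Stage-12 parameter carrying the residuals of record `θ.Rz K` is the unit recipe (companion's `rz_eq_unit_of_hasResidualsOfRecord`, private copy).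
[cite: Balaban1987RG1, (1.15) p.262 (bookkeeping)] -/
private theorem rz_eq_of_hasResidualsOfRecord {θ : Stage12Params F N} (h : θ.HasResidualsOfRecord F N) (K : ℕ) :
    θ.Rz K = Sect2.Residual.unit (F.P K) (MatA N) := by
  rw [h.Rz_eq]; rfl

/-- **(C) AT `RzOfRecord F N K`**: the honest horn `B12Provisos (RzOfRecord F N K) cB λ` is inhabited by a zero-letter layer (`M ≥ 1`, `0 < O(1)LMB`).
[cite: Balaban1987RG1, Lemma 4 p.280 (bookkeeping: junk witness at the record's §2 datum)] -/
theorem exists_b12Provisos_RzOfRecord (K : ℕ) {M : ℕ} (hM : 1 ≤ M) {cB : ℝ} (hcB : 0 < cB) :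
    ∃ lam : ResidB12Run (F.P K) N M, lam.idx.XSites ⊆ lam.idx.boxT 2 ∧ (∀ Φ A τ, lam.K Φ A τ = 0) ∧ (∀ Φ A τ B', lam.A₂ Φ A τ B' = 0) ∧
      B12Provisos (RzOfRecord F N K) cB lam :=
  exists_b12Provisos_of_eq_unit (rzOfRecord_eq K) hM hcB

/-- **(C) AT A STAGE-12 PARAMETER CARRYING THE RESIDUALS OF RECORD** (`θ.HasResidualsOfRecord`, `0 < O(1)LMB = θ.s2.cB`, cube size `θ.τ9.M ≥ 1`): a residual [B12] layer `λ₁₂` ALL of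
whose runs carry the honest horn `B12Provisos (θ.Rz P.K) θ.s2.cB (λ₁₂ P)` — with zero letters.  JUNK witness for the binders. [cite: Balaban1987RG1, Lemma 4 p.280 (bookkeeping)] -/
theorem exists_lam12_b12Provisos_of_hasResidualsOfRecord {θ : Stage12Params F N} (h : θ.HasResidualsOfRecord F N) (hcB : 0 < θ.s2.cB) (hM : 1 ≤ θ.τ9.M) :
    ∃ lam12 : ResidB12 F N θ.τ9.M, ∀ P : B12.RunParams,
      (lam12 P).idx.XSites ⊆ (lam12 P).idx.boxT 2 ∧ (∀ Φ A τ, (lam12 P).K Φ A τ = 0) ∧ (∀ Φ A τ B', (lam12 P).A₂ Φ A τ B' = 0) ∧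
        B12Provisos (θ.Rz P.K) θ.s2.cB (lam12 P) := by
  have hex : ∀ P : B12.RunParams, ∃ lam : ResidB12Run (F.P P.K) N θ.τ9.M,
      lam.idx.XSites ⊆ lam.idx.boxT 2 ∧ (∀ Φ A τ, lam.K Φ A τ = 0) ∧ (∀ Φ A τ B', lam.A₂ Φ A τ B' = 0) ∧ B12Provisos (θ.Rz P.K) θ.s2.cB lam :=
    fun P => exists_b12Provisos_of_eq_unit (rz_eq_of_hasResidualsOfRecord h P.K) hM hcB
  exact ⟨fun P => Classical.choose (hex P), fun P => Classical.choose_spec (hex P)⟩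

/-- **(C) ⇒ N09's CONJUNCT 1 IN PACKAGE FORM IS CLOSABLE BY JUNK AT EVERY STAGE-12 PARAMETER CARRYING THE RESIDUALS OF RECORD**: SOME residual [B12] layer `λ₁₂` (zero letters) has g32's
Stage-12 leaf `B12LeafOfRecord₁₂ F N θ λ₁₂ P` at EVERY run (node00-def-B12's `B12Provisos.leaf` on §3's horn).  LOCATED hollow-closure certificate — NOT Lemma 4 for print's letters,
NOT a discharge of N09, count-neutral. [cite: Balaban1987RG1, Lemma 4 (3.53) p.280 (bookkeeping)] -/
theorem exists_lam12_b12LeafOfRecord₁₂_of_hasResidualsOfRecord {θ : Stage12Params F N} (h : θ.HasResidualsOfRecord F N) (hcB : 0 < θ.s2.cB) (hM : 1 ≤ θ.τ9.M) :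
    ∃ lam12 : ResidB12 F N θ.τ9.M, (∀ P : B12.RunParams, (∀ Φ A τ, (lam12 P).K Φ A τ = 0) ∧ (∀ Φ A τ B', (lam12 P).A₂ Φ A τ B' = 0)) ∧
      ∀ P : B12.RunParams, B12LeafOfRecord₁₂ F N θ lam12 P := by
  obtain ⟨lam12, hlam⟩ := exists_lam12_b12Provisos_of_hasResidualsOfRecord h hcB hM
  exact ⟨lam12, fun P => ⟨(hlam P).2.1, (hlam P).2.2.1⟩, fun P => (hlam P).2.2.2.leaf hcB⟩

/-- **(C) AT THE V17∕V18 WITNESS `θ₁₅ᶜᶜᴹᵂ(j; γ; ε₀, ε₂₉; B₃, B₃′, a₀, a₁)` BY NAME** (`N` arbitrary, any `j`; its `O(1)LMB = 6L + 1 > 0`, its cube size `M = Lʲ ≥ 1`, its `Rz = RzOfRecord`): SOME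
zero-letter residual [B12] layer has the Stage-12 leaf `B12LeafOfRecord₁₂` at every run of the witness — the leaf that `Record13CarriersXPinnedH.socket09_pinX3H_iff` puts under the
four-pin engine's `h09` at `θ₁₅ᶜᶜᴹᵂ.pinX3H λ₈ λ₁₂ λ₁₃`.  LOCATED hollow-closure certificate for the K1⁷ road; NOT Lemma 4 for print's letters; N09 NOT discharged; K1⁷ NOT closed.
[cite: Balaban1987RG1, Lemma 4 (3.53) p.280; Balaban1989LargeFieldI, (0.3) p.176 (the witness, bookkeeping)] -/
theorem exists_lam12_b12LeafOfRecord₁₂_theta13OfThm1CCMW (j : ℕ) (γ ε₀ ε₂₉ B₃ B₃' a₀ a₁ : ℝ) :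
    ∃ lam12 : ResidB12 F N (theta13OfThm1CCMW F N j γ ε₀ ε₂₉ B₃ B₃' a₀ a₁).τ9.M,
      (∀ P : B12.RunParams, (∀ Φ A τ, (lam12 P).K Φ A τ = 0) ∧ (∀ Φ A τ B', (lam12 P).A₂ Φ A τ B' = 0)) ∧
      ∀ P : B12.RunParams, B12LeafOfRecord₁₂ F N (theta13OfThm1CCMW F N j γ ε₀ ε₂₉ B₃ B₃' a₀ a₁).toStage12Params lam12 P := by
  refine exists_lam12_b12LeafOfRecord₁₂_of_hasResidualsOfRecord (hasResidualsOfRecord_theta13OfThm1CCMW F N j γ ε₀ ε₂₉ B₃ B₃' a₀ a₁) ?_ ?_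
  · rw [theta13OfThm1CCMW_s2, sect2NumericsOfThm1C_cB]; positivity
  · rw [theta13OfThm1CCMW_τ9_M]; exact Nat.one_le_pow _ _ (by have := F.hL.2; omega)

end JunkRecord

/-! ## §4. At the four-pin engine's `h09` socket: the X-pinned Stage-13 parameter `θ.pinX3H λ₈ λ₁₂ λ₁₃` (dag-n05-d `Record13CarriersXPinnedH`) -/

section Socket

variable {F : T4Family} {N : ℕ} [NeZero N]

/-- **(C) AT THE X-PINNED STAGE-13 PARAMETER**: for a Stage-13 parameter carrying the residuals of record (`0 < O(1)LMB`, cube size `≥ 1`), SOME zero-letter residual [B12] layer `λ₁₂` makes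
the four-pin engine's N09 socket `h09 : ∀ P, Lemma4Printed ((θ.pinX3H λ₈ λ₁₂ λ₁₃).res.X P).F12 (…).c12` TRUE for EVERY `λ₈`, `λ₁₃` and every run (dag-n05-d's `socket09_pinX3H_iff`, `Iff.rfl`, on §3).
LOCATED hollow-closure certificate: the socket is met WITHOUT print's letters; NOT Lemma 4 for `U_j(□₀, ·)`; N09 NOT discharged; K1⁷ NOT closed; count-neutral.
[cite: Balaban1987RG1, Lemma 4 (3.53) p.280 (bookkeeping)] -/
theorem exists_lam12_socket09_pinX3H_of_hasResidualsOfRecord {θ : Stage13Params F N} (h : θ.HasResidualsOfRecord F N) (hcB : 0 < θ.s2.cB) (hM : 1 ≤ θ.τ9.M) :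
    ∃ lam12 : ResidB12 F N θ.τ9.M, (∀ P : B12.RunParams, (∀ Φ A τ, (lam12 P).K Φ A τ = 0) ∧ (∀ Φ A τ B', (lam12 P).A₂ Φ A τ B' = 0)) ∧
      ∀ (lam8 : ResidB8 θ.toStage3Params) (lam13 : B12.RunParams → ResidB13 θ.toStage3Params) (P : B12.RunParams),
        B12Sec2to5.Lemma4Printed ((θ.pinX3H F N lam8 lam12 lam13).res.X P).F12 ((θ.pinX3H F N lam8 lam12 lam13).res.X P).c12 := by
  obtain ⟨lam12, hz, hleaf⟩ := exists_lam12_b12LeafOfRecord₁₂_of_hasResidualsOfRecord (θ := θ.toStage12Params) h hcB hM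
  exact ⟨lam12, hz, fun lam8 lam13 P => (socket09_pinX3H_iff F N θ lam8 lam12 lam13 P).2 (hleaf P)⟩

/-- **(C) AT THE X-PINNED V17∕V18 WITNESS `θ₁₅ᶜᶜᴹᵂ.pinX3H λ₈ λ₁₂ λ₁₃` BY NAME**: SOME zero-letter `λ₁₂` meets the engine's N09 socket at every `λ₈`, `λ₁₃`, every run.  LOCATED hollow-closure
certificate for the K1⁷ road at the witness of record; NOT Lemma 4 for print's letters; N09 NOT discharged; K1⁷ NOT closed; count-neutral.
[cite: Balaban1987RG1, Lemma 4 (3.53) p.280; Balaban1989LargeFieldI, (0.3) p.176 (the witness, bookkeeping)] -/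
theorem exists_lam12_socket09_pinX3H_theta13OfThm1CCMW (j : ℕ) (γ ε₀ ε₂₉ B₃ B₃' a₀ a₁ : ℝ) :
    ∃ lam12 : ResidB12 F N (theta13OfThm1CCMW F N j γ ε₀ ε₂₉ B₃ B₃' a₀ a₁).τ9.M,
      (∀ P : B12.RunParams, (∀ Φ A τ, (lam12 P).K Φ A τ = 0) ∧ (∀ Φ A τ B', (lam12 P).A₂ Φ A τ B' = 0)) ∧
      ∀ (lam8 : ResidB8 (theta13OfThm1CCMW F N j γ ε₀ ε₂₉ B₃ B₃' a₀ a₁).toStage3Params)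
        (lam13 : B12.RunParams → ResidB13 (theta13OfThm1CCMW F N j γ ε₀ ε₂₉ B₃ B₃' a₀ a₁).toStage3Params) (P : B12.RunParams),
        B12Sec2to5.Lemma4Printed (((theta13OfThm1CCMW F N j γ ε₀ ε₂₉ B₃ B₃' a₀ a₁).pinX3H F N lam8 lam12 lam13).res.X P).F12
          (((theta13OfThm1CCMW F N j γ ε₀ ε₂₉ B₃ B₃' a₀ a₁).pinX3H F N lam8 lam12 lam13).res.X P).c12 := by
  refine exists_lam12_socket09_pinX3H_of_hasResidualsOfRecord (hasResidualsOfRecord_theta13OfThm1CCMW F N j γ ε₀ ε₂₉ B₃ B₃' a₀ a₁) ?_ ?_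
  · rw [theta13OfThm1CCMW_s2, sect2NumericsOfThm1C_cB]; positivity
  · rw [theta13OfThm1CCMW_τ9_M]; exact Nat.one_le_pow _ _ (by have := F.hL.2; omega)

end Socket

end Summit.QuantumFields.YangMills.BalabanUVNodes.N09B12ProvisosAtRzOfRecordJunkLocated

end
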